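import Literature.Computability.AlgebraicComplexity.PerDetMultiplicityObstruction
import HarnessLib

/-!
# Kinds of multiplicity obstructions for `det_m` versus the padded permanent: certificate shapes

Topic `Literature/Computability/AlgebraicComplexity`; companion of `PerDetMultiplicityObstruction.lean`
(the three renderings of "`λ` is a multiplicity obstruction at `(n, m)`" and the chain
`obstruction ⇒ X₀₀^{m-n} per_n ∉ Δ(det_m) ⇒ dc(per_n) > m`) and of `ObstructionTypes.lean` (the
printed typology of multiplicity obstructions for a pair of forms `(f, g)`:
`IsOccurrenceObstructionAt`, `IsVanishingIdealOccurrenceObstructionAt`,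
`IsPureMultiplicityObstructionAt`, with the trichotomy `isMultiplicityObstructionAt_trichotomy`).

Dörfler–Ikenmeyer–Panova (SIAGA 4 (2020) = arXiv:1901.04576, §2, after eq. (2.2)): "Such a `λ` is
called a *multiplicity obstruction*. If additionally `mult_λ(ℂ[Ch_m^n]_d) = 0`, then `λ` is called
an *occurrence obstruction*."  Ikenmeyer–Kandasamy (arXiv:1911.03990, §2): obstructions that "occur in
the vanishing ideal of one orbit closure, but not in the vanishing ideal of the other" are
*vanishing ideal occurrence obstructions*; a multiplicity obstruction that is neither is *pure*
(Prop. 5.3).  Bürgisser–Ikenmeyer–Panova (J. AMS 32 (2019), Thm. 1.4) exclude occurrence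
obstructions for `det` versus the padded permanent asymptotically; nothing in print excludes, or
exhibits, multiplicity obstructions of the other kinds at fixed small `(n, m)`.

This file specialises the typology to the pair (`detFormLex k m`, `paddedPerFormLex k n m`) of the
tree and records, as theorems with purely numerical hypotheses, WHICH KIND an explicit certificate
establishes.  A certificate of the engine kind carries (cell coordinates `n` = permanent size,
`m` = determinant size, `λ ⊢ m d`, `ℓ(λ) ≤ m²`):

* a permanent-side rank `r ≤ mult_{λ*} k[Δ(X₀₀^{m-n} per_n)]` (nonsingular `r × r` evaluation
  matrix of weight-`λ*` highest-weight vectors at points of the orbit closure — tree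
  `HwvEvaluationRankBound.lean`),
* the det-side number `s = sk(λ, m × d) ≥ mult_{λ*} k[Δ(det_m)]` (BLMW 2011 Prop. 5.2.1; tree
  `orbitMultiplicity_det_le_symKroneckerCoeffRect`), with `s < r`,
* optionally a det-side rank `r' ≤ mult_{λ*} k[Δ(det_m)]` obtained by the same evaluation at
  points of `Δ(det_m)`, and the ambient multiplicity `a = mult_{λ*} k[Sym^m]` (plethysm
  coefficient; `mult ≤ a` on both sides, BLMW §4.4, tree `orbitMultiplicity_le_plethysmCoeff_holds`).

What the numbers decide (all proved below, elementary over the cited tree theorems):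

1. `s = 0` (so `r ≥ 1`): an OCCURRENCE obstruction (`isOccurrenceObstructionAt_perDet_of_…`).
2. `1 ≤ r'`: NOT an occurrence obstruction; with `s < r` a multiplicity obstruction "that is not
   an occurrence obstruction" in the words of DIP20 (`…_and_not_isOccurrenceObstructionAt_…`).
3. `r = a` and `s < a`: a VANISHING IDEAL OCCURRENCE obstruction (a weight-`λ*` highest-weight
   vector lies in `I(Δ(det_m))`, none in `I(Δ(X₀₀^{m-n} per_n))`); in particular such a row is
   never "pure" in the sense of Ikenmeyer–Kandasamy (`not_isPureMultiplicityObstructionAt_…`).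
4. `1 ≤ r'`, `s < r`, `r ≤ mult_per < a`: a PURE multiplicity obstruction needs an upper bound on
   the permanent side strictly below `a`, which no evaluation certificate supplies; recorded as the
   exact hypothesis list (`isPureMultiplicityObstructionAt_perDet_of_bounds`).

No new definitions and no named facts: every statement is a theorem over `ObstructionTypes.lean`,
`PerDetMultiplicityObstruction.lean`, `DetOrbitSymKroneckerBound.lean` and
`MultiplicityObstructionsProofs.lean`.

## References

* J. Dörfler, C. Ikenmeyer, G. Panova, *On geometric complexity theory: Multiplicity obstructions
  are stronger than occurrence obstructions*, SIAM J. Appl. Algebra Geom. 4 (2020) 354–376 =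
  arXiv:1901.04576, §2 (definitions after eq. (2.2)). [DorflerIkenmeyerPanova2020]
* C. Ikenmeyer, U. Kandasamy, *Implementing geometric complexity theory: on the separation of orbit
  closures via symmetries*, STOC 2020 = arXiv:1911.03990, §2 and Prop. 5.3. [IkenmeyerKandasamy2019]
* P. Bürgisser, C. Ikenmeyer, G. Panova, *No occurrence obstructions in geometric complexity
  theory*, J. Amer. Math. Soc. 32 (2019) 163–193, §1.1 and Thm. 1.4. [BurgisserIkenmeyerPanovaJAMS2019]
* P. Bürgisser, J. M. Landsberg, L. Manivel, J. Weyman, *An overview of mathematical issues arising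
  in the geometric complexity theory approach to VP ≠ VNP*, SIAM J. Comput. 40 (2011), §4.4 and
  §5.2 Prop. 5.2.1. [BLMW2011]

## Mathlib and tree

Tree: `IsMultiplicityObstructionAt`, `IsOccurrenceObstructionAt`,
`IsVanishingIdealOccurrenceObstructionAt`, `IsPureMultiplicityObstructionAt`
(`ObstructionTypes.lean`); `PerDetMultiplicityObstruction`, `PerDetSymKroneckerObstructionAt`
(`PerDetMultiplicityObstruction.lean`); `orbitMultiplicity_det_le_symKroneckerCoeffRect`
(`DetOrbitSymKroneckerBound.lean`); `orbitMultiplicity_le_plethysmCoeff_holds`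
(`MultiplicityObstructionsProofs.lean`); `paddedPerFormLex_isHomogeneous` (`SchurWeylPlethysm.lean`).
-/

namespace Literature.Computability.AlgebraicComplexity

open _root_.Literature.NumberTheory.DiophantineGeometry

variable {k : Type} [Field k]

/-! ### 1. `sk = 0`: occurrence obstructions -/

/-- **A certificate with `sk(λ, m × d) = 0` is an occurrence obstruction.** If `ℓ(λ) ≤ m²`,
`sk(λ, m × d) = 0` and some weight-`λ*` highest-weight vector is nonzero on `Δ(X₀₀^{m-n} per_n)`
(`1 ≤ mult`), then `λ*` is an occurrence obstruction against `X₀₀^{m-n} per_n ∈ Δ(det_m)` in the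
sense of BIP19 §1.1 / DIP20 §2: `mult_{λ*} k[Δ(det_m)] = 0 < mult_{λ*} k[Δ(X₀₀^{m-n} per_n)]`
(the det side vanishes by BLMW Prop. 5.2.1, `mult ≤ sk`). [cite: DorflerIkenmeyerPanova2020, §2] -/
theorem isOccurrenceObstructionAt_perDet_of_symKroneckerCoeffRect_eq_zero [CharZero k] {n m d : ℕ}
    [NeZero m] {lam : Nat.Partition (m * d)} (hlam : lam.parts.card ≤ m * m)
    (hsk : symKroneckerCoeffRect k m d lam = 0)
    (hper : 1 ≤ orbitMultiplicity k (paddedPerFormLex k n m) m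
      (Weight.dualOfPartition (m * m) lam).toMatIdx) :
    IsOccurrenceObstructionAt (detFormLex k m) (paddedPerFormLex k n m) m
      (Weight.dualOfPartition (m * m) lam).toMatIdx := by
  have hdet := orbitMultiplicity_det_le_symKroneckerCoeffRect k m lam hlam
  rw [hsk] at hdet
  unfold IsOccurrenceObstructionAt
  omega

/-- The same certificate is, a fortiori, a symmetric-Kronecker-form obstruction of
`PerDetMultiplicityObstruction.lean` (hence `dc(per_n) > m` by
`lt_determinantalComplexity_perPoly_of_perDetSymKroneckerObstructionAt`). [cite: BLMW2011, §5.2 Prop. 5.2.1] -/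
theorem perDetSymKroneckerObstructionAt_of_symKroneckerCoeffRect_eq_zero {n m d : ℕ} [NeZero m]
    {lam : Nat.Partition (m * d)} (hnm : n ≤ m) (hlam : lam.parts.card ≤ m * m)
    (hsk : symKroneckerCoeffRect k m d lam = 0)
    (hper : 1 ≤ orbitMultiplicity k (paddedPerFormLex k n m) m
      (Weight.dualOfPartition (m * m) lam).toMatIdx) :
    PerDetSymKroneckerObstructionAt (k := k) n m d lam :=
  ⟨hnm, hlam, by rw [hsk]; exact hper⟩

/-! ### 2. A det-side rank: multiplicity obstructions that are not occurrence obstructions -/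

/-- **A nonzero evaluation on the determinant side excludes the occurrence kind**: if some
weight-`χ` highest-weight vector is nonzero at a point of `Δ(det_m)` (`1 ≤ mult_χ k[Δ(det_m)]`,
e.g. by the rank bound of `HwvEvaluationRankBound.lean` at points `g · det_m`), then `χ` is not an
occurrence obstruction against `X₀₀^{m-n} per_n ∈ Δ(det_m)`. [cite: DorflerIkenmeyerPanova2020, §2] -/
theorem not_isOccurrenceObstructionAt_perDet_of_det_pos {n m : ℕ} [NeZero m] {χ : Weight (MatIdx m)}
    (hdet : 1 ≤ orbitMultiplicity k (detFormLex k m) m χ) :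
    ¬ IsOccurrenceObstructionAt (detFormLex k m) (paddedPerFormLex k n m) m χ := by
  unfold IsOccurrenceObstructionAt
  omega

/-- **Certificate shape "multiplicity obstruction that is not an occurrence obstruction"**
(DIP20 §2; the phenomenon of their Main Theorem, here for the pair det / padded per): `n ≤ m`,
`ℓ(λ) ≤ m²`, the det-side number `sk(λ, m × d) < r`, a permanent-side rank
`r ≤ mult_{λ*} k[Δ(X₀₀^{m-n} per_n)]`, and a det-side rank `1 ≤ r' ≤ mult_{λ*} k[Δ(det_m)]` give a
symmetric-Kronecker-form obstruction which is NOT an occurrence obstruction: `λ*` occurs in both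
coordinate rings, with different multiplicities. [cite: DorflerIkenmeyerPanova2020, §2] -/
theorem perDetSymKroneckerObstructionAt_and_not_isOccurrenceObstructionAt_of_ranks {n m d : ℕ}
    [NeZero m] {lam : Nat.Partition (m * d)} (hnm : n ≤ m) (hlam : lam.parts.card ≤ m * m)
    {r r' : ℕ} (hsr : symKroneckerCoeffRect k m d lam < r)
    (hr : r ≤ orbitMultiplicity k (paddedPerFormLex k n m) m
      (Weight.dualOfPartition (m * m) lam).toMatIdx)
    (hr'pos : 1 ≤ r')
    (hr' : r' ≤ orbitMultiplicity k (detFormLex k m) m (Weight.dualOfPartition (m * m) lam).toMatIdx) :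
    PerDetSymKroneckerObstructionAt (k := k) n m d lam ∧
      ¬ IsOccurrenceObstructionAt (detFormLex k m) (paddedPerFormLex k n m) m
        (Weight.dualOfPartition (m * m) lam).toMatIdx :=
  ⟨⟨hnm, hlam, lt_of_lt_of_le hsr hr⟩,
    not_isOccurrenceObstructionAt_perDet_of_det_pos (hr'pos.trans hr')⟩

/-- In characteristic zero the conclusion of the previous theorem is a genuine multiplicity
obstruction that is not an occurrence obstruction (numeric typology of `ObstructionTypes.lean`).
[cite: DorflerIkenmeyerPanova2020, §2] -/
theorem isMultiplicityObstructionAt_and_not_isOccurrenceObstructionAt_of_ranks [CharZero k]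
    {n m d : ℕ} [NeZero m] {lam : Nat.Partition (m * d)} (hnm : n ≤ m)
    (hlam : lam.parts.card ≤ m * m) {r r' : ℕ} (hsr : symKroneckerCoeffRect k m d lam < r)
    (hr : r ≤ orbitMultiplicity k (paddedPerFormLex k n m) m
      (Weight.dualOfPartition (m * m) lam).toMatIdx)
    (hr'pos : 1 ≤ r')
    (hr' : r' ≤ orbitMultiplicity k (detFormLex k m) m (Weight.dualOfPartition (m * m) lam).toMatIdx) :
    IsMultiplicityObstructionAt (detFormLex k m) (paddedPerFormLex k n m) m
        (Weight.dualOfPartition (m * m) lam).toMatIdx ∧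
      ¬ IsOccurrenceObstructionAt (detFormLex k m) (paddedPerFormLex k n m) m
        (Weight.dualOfPartition (m * m) lam).toMatIdx := by
  obtain ⟨hobs, hnot⟩ :=
    perDetSymKroneckerObstructionAt_and_not_isOccurrenceObstructionAt_of_ranks
      (k := k) hnm hlam hsr hr hr'pos hr'
  exact ⟨hobs.perDetMultiplicityObstructionAt.perDetMultiplicityObstruction.2, hnot⟩

/-! ### 3. Full permanent-side rank `r = a`: vanishing ideal occurrence obstructions -/

/-- **A certificate of full ambient rank is a vanishing ideal occurrence obstruction.** In
characteristic zero, if `n ≤ m`, `ℓ(λ) ≤ m²`, `sk(λ, m × d) < a` and `a ≤ mult_{λ*} k[Δ(X₀₀^{m-n} per_n)]`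
where `a = mult_{λ*} k[Sym^m]` is the ambient (plethysm) multiplicity, then
`mult_{λ*} k[Δ(det_m)] < a = mult_{λ*} k[Δ(X₀₀^{m-n} per_n)]`: a weight-`λ*` highest-weight vector lies
in the ideal of `Δ(det_m)` and none in the ideal of `Δ(X₀₀^{m-n} per_n)` — Ikenmeyer–Kandasamy's
"vanishing ideal occurrence obstruction" (the permanent side attains the ambient bound by BLMW
§4.4, `orbitMultiplicity_le_plethysmCoeff_holds`). [cite: IkenmeyerKandasamy2019, §2] -/
theorem isVanishingIdealOccurrenceObstructionAt_perDet_of_rank_eq_plethysmCoeff [CharZero k]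
    {n m d : ℕ} [NeZero m] {lam : Nat.Partition (m * d)} (hnm : n ≤ m)
    (hlam : lam.parts.card ≤ m * m)
    (hsk : symKroneckerCoeffRect k m d lam <
      plethysmCoeff k (MatIdx m) m (Weight.dualOfPartition (m * m) lam).toMatIdx)
    (hper : plethysmCoeff k (MatIdx m) m (Weight.dualOfPartition (m * m) lam).toMatIdx ≤
      orbitMultiplicity k (paddedPerFormLex k n m) m (Weight.dualOfPartition (m * m) lam).toMatIdx) :
    IsVanishingIdealOccurrenceObstructionAt (detFormLex k m) (paddedPerFormLex k n m) m
      (Weight.dualOfPartition (m * m) lam).toMatIdx := by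
  have hdet := orbitMultiplicity_det_le_symKroneckerCoeffRect k m lam hlam
  have hup := orbitMultiplicity_le_plethysmCoeff_holds (k := k) (paddedPerFormLex k n m)
    (NeZero.ne m) (paddedPerFormLex_isHomogeneous (k := k) hnm)
    (Weight.dualOfPartition (m * m) lam).toMatIdx
  unfold IsVanishingIdealOccurrenceObstructionAt
  omega

/-- Such a full-rank certificate is never a *pure* multiplicity obstruction in the sense of
Ikenmeyer–Kandasamy (which asks `mult_{λ*} k[Δ(X₀₀^{m-n} per_n)] < a`). [cite: IkenmeyerKandasamy2019, Prop. 5.3] -/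
theorem not_isPureMultiplicityObstructionAt_perDet_of_plethysmCoeff_le {n m : ℕ} [NeZero m]
    {χ : Weight (MatIdx m)}
    (hper : plethysmCoeff k (MatIdx m) m χ ≤ orbitMultiplicity k (paddedPerFormLex k n m) m χ) :
    ¬ IsPureMultiplicityObstructionAt (detFormLex k m) (paddedPerFormLex k n m) m χ := by
  unfold IsPureMultiplicityObstructionAt
  omega

/-- With a det-side rank `1 ≤ r' ≤ mult_{λ*} k[Δ(det_m)]` in addition, a full-rank certificate is a
vanishing ideal occurrence obstruction that is NOT an occurrence obstruction: `λ*` occurs in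
`k[Δ(det_m)]`, in `k[Δ(X₀₀^{m-n} per_n)]` and in the ideal of `Δ(det_m)`, but not in the ideal of
`Δ(X₀₀^{m-n} per_n)`. [cite: IkenmeyerKandasamy2019, §2] -/
theorem isVanishingIdealOccurrenceObstructionAt_and_not_isOccurrenceObstructionAt [CharZero k]
    {n m d : ℕ} [NeZero m] {lam : Nat.Partition (m * d)} (hnm : n ≤ m)
    (hlam : lam.parts.card ≤ m * m)
    (hsk : symKroneckerCoeffRect k m d lam <
      plethysmCoeff k (MatIdx m) m (Weight.dualOfPartition (m * m) lam).toMatIdx)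
    (hper : plethysmCoeff k (MatIdx m) m (Weight.dualOfPartition (m * m) lam).toMatIdx ≤
      orbitMultiplicity k (paddedPerFormLex k n m) m (Weight.dualOfPartition (m * m) lam).toMatIdx)
    {r' : ℕ} (hr'pos : 1 ≤ r')
    (hr' : r' ≤ orbitMultiplicity k (detFormLex k m) m (Weight.dualOfPartition (m * m) lam).toMatIdx) :
    IsVanishingIdealOccurrenceObstructionAt (detFormLex k m) (paddedPerFormLex k n m) m
        (Weight.dualOfPartition (m * m) lam).toMatIdx ∧
      ¬ IsOccurrenceObstructionAt (detFormLex k m) (paddedPerFormLex k n m) m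
        (Weight.dualOfPartition (m * m) lam).toMatIdx :=
  ⟨isVanishingIdealOccurrenceObstructionAt_perDet_of_rank_eq_plethysmCoeff (k := k) hnm hlam hsk hper,
    not_isOccurrenceObstructionAt_perDet_of_det_pos (hr'pos.trans hr')⟩

/-! ### 4. The hypothesis list of a pure multiplicity obstruction -/

/-- **What a pure multiplicity obstruction would need.** For the pair det / padded per the kind
"pure multiplicity obstruction" of Ikenmeyer–Kandasamy (`0 < mult_det < mult_per < a`) follows from
a det-side rank `1 ≤ r' ≤ mult_{λ*} k[Δ(det_m)]`, the det-side number `mult ≤ sk < r`, a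
permanent-side rank `r ≤ mult_{λ*} k[Δ(X₀₀^{m-n} per_n)]`, AND an upper bound
`mult_{λ*} k[Δ(X₀₀^{m-n} per_n)] < a` — the last is an equation for the padded permanent's orbit
closure, which evaluation certificates do not provide; it is listed here as an explicit hypothesis.
[cite: IkenmeyerKandasamy2019, §2 and Prop. 5.3] -/
theorem isPureMultiplicityObstructionAt_perDet_of_bounds [CharZero k] {n m d : ℕ} [NeZero m]
    {lam : Nat.Partition (m * d)} (hlam : lam.parts.card ≤ m * m) {r r' : ℕ}
    (hr'pos : 1 ≤ r')
    (hr' : r' ≤ orbitMultiplicity k (detFormLex k m) m (Weight.dualOfPartition (m * m) lam).toMatIdx)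
    (hsr : symKroneckerCoeffRect k m d lam < r)
    (hr : r ≤ orbitMultiplicity k (paddedPerFormLex k n m) m
      (Weight.dualOfPartition (m * m) lam).toMatIdx)
    (hup : orbitMultiplicity k (paddedPerFormLex k n m) m (Weight.dualOfPartition (m * m) lam).toMatIdx <
      plethysmCoeff k (MatIdx m) m (Weight.dualOfPartition (m * m) lam).toMatIdx) :
    IsPureMultiplicityObstructionAt (detFormLex k m) (paddedPerFormLex k n m) m
      (Weight.dualOfPartition (m * m) lam).toMatIdx := by
  have hdet := orbitMultiplicity_det_le_symKroneckerCoeffRect k m lam hlam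
  unfold IsPureMultiplicityObstructionAt
  omega

end Literature.Computability.AlgebraicComplexity
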